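import Summits.CriticalPhenomena.Ising3DConformalLimit.Theorems.PrecisionLaplacianMoebiusLimitOfTwoPointLawBareFactorisation
import Summits.CriticalPhenomena.Ising3DConformalLimit.Theorems.GaussianScaleMixtureRotationUpgradeFromTwoPoint
import HarnessLib

/-!
# Crux `MoebiusLimitOfTwoPointLaw` (item stmt-CriticalPhenomena-4801) — the strategist's SPLIT into two existing items
# (`--supports stmt-CriticalPhenomena-4801`; glue of `route edit --split MoebiusLimitOfTwoPointLaw --into {4738, 1982}`)

The landed exact residue `crux ↔ (0634 → 4738 ∧ 8367 ∧ 1982)` (`moebiusLimitOfTwoPointLaw_iff_bare₂`, p117654) has lost a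
factor: item stmt-CriticalPhenomena-8367 `GaussianScaleMixture.RotationUpgradeFromTwoPoint` (the `n`-point `O(3)` upgrade from
two-point isotropy) is now a THEOREM of the tree (`rotationUpgradeFromTwoPoint_proof`, line `null-laplacian-edge-gaussianity`;
and item 1980 `HyperoctahedralRP.LimitRotationInvariant` likewise, line `quarter-turn-liouville`). Hence:

* `moebiusLimitOfTwoPointLaw_of_subs`  : `WeylWindow.LimitExists → HyperoctahedralRP.InversionUpgradeNormalised → crux`
  (items 4738 → 1982 → 4801; both host spellings), the glue of the two-child split of the crux;
* `moebiusLimitOfTwoPointLaw_iff_subs` : `crux ↔ (0634 → 4738 ∧ 1982)` — the residue is now EXACTLY "bare existence of a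
  non-degenerate pointwise scaling limit (the existence problem, item 4738 ⇔ 1981 under 0634) + the inversion upgrade of every
  normalised Euclidean scale-covariant limit (the conformal problem, item 1982)", each factor necessary given item 0634;
* `limitRotationInvariant_holds_of_twoPointLaw` : under item 0634 the conclusion of item 1980 for every limit, by name.

Nothing Ising-specific is proved here; this file is routing glue over landed theorems (p116785, p117654, the 8367 proof).
References: H. Duminil-Copin, ICM 2022 §8.4 p. 29 (existence and conformal covariance open on `ℤ³`). No definitions, no `sorry`.
-/

noncomputable section

namespace Summit.CriticalPhenomena.Ising3DConformalLimit.BernsteinTemperatureMoebiusLimitOfTwoPointLawSplit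

open Summit.CriticalPhenomena.Ising3DConformalLimit.Theses
open Summit.CriticalPhenomena.Ising3DConformalLimit.PrecisionLaplacianMoebiusLimitOfTwoPointLaw
  (moebiusLimitOfTwoPointLaw_of_bare₂ moebiusLimitOfTwoPointLaw_iff_bare₂
    limitRotationInvariant_of_rotationUpgradeFromTwoPoint)
open Summit.CriticalPhenomena.Ising3DConformalLimit.Cruxes.RotationUpgradeFromTwoPoint.NullLaplacianEdgeGaussianity
  (rotationUpgradeFromTwoPoint_proof)

/-- The `O(3)` factor of the residue is a theorem of the tree (item stmt-CriticalPhenomena-8367, proved). [folklore] -/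
theorem rotationUpgradeFromTwoPoint_holds : GaussianScaleMixture.RotationUpgradeFromTwoPoint :=
  rotationUpgradeFromTwoPoint_proof

/-- **Split glue** (`PrecisionLaplacian` spelling): items 4738 → 1982 → crux 4801.
[cite: DuminilCopinICM2022, §8.4 p. 29] -/
theorem moebiusLimitOfTwoPointLaw_of_subs'
    (hL : WeylWindow.LimitExists) (hI : HyperoctahedralRP.InversionUpgradeNormalised) :
    PrecisionLaplacian.MoebiusLimitOfTwoPointLaw :=
  moebiusLimitOfTwoPointLaw_of_bare₂ hL rotationUpgradeFromTwoPoint_proof hI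

/-- **Split glue** (`BernsteinTemperature` spelling, identical definiens): items 4738 → 1982 → crux 4801 — the type is
literally `LimitExists → InversionUpgradeNormalised → MoebiusLimitOfTwoPointLaw` for the two children filed on route
`BernsteinTemperature`. [cite: DuminilCopinICM2022, §8.4 p. 29] -/
theorem moebiusLimitOfTwoPointLaw_of_subs
    (hL : WeylWindow.LimitExists) (hI : HyperoctahedralRP.InversionUpgradeNormalised) :
    BernsteinTemperature.MoebiusLimitOfTwoPointLaw :=
  moebiusLimitOfTwoPointLaw_of_subs' hL hI

/-- **Exact two-factor residue**: `crux ↔ (0634 → 4738 ∧ 1982)` (`PrecisionLaplacian` spelling).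
[cite: DuminilCopinICM2022, §8.4 p. 29] -/
theorem moebiusLimitOfTwoPointLaw_iff_subs' :
    PrecisionLaplacian.MoebiusLimitOfTwoPointLaw ↔
      (IsingEuclidUpgrade.IsingEuclidUpgradeR2RotInvPowerLaw →
        WeylWindow.LimitExists ∧ HyperoctahedralRP.InversionUpgradeNormalised) := by
  rw [moebiusLimitOfTwoPointLaw_iff_bare₂]
  constructor
  · intro h hP
    exact ⟨(h hP).1, (h hP).2.2⟩
  · intro h hP
    exact ⟨(h hP).1, rotationUpgradeFromTwoPoint_proof, (h hP).2⟩

/-- **Exact two-factor residue** (`BernsteinTemperature` spelling). [cite: DuminilCopinICM2022, §8.4 p. 29] -/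
theorem moebiusLimitOfTwoPointLaw_iff_subs :
    BernsteinTemperature.MoebiusLimitOfTwoPointLaw ↔
      (IsingEuclidUpgrade.IsingEuclidUpgradeR2RotInvPowerLaw →
        WeylWindow.LimitExists ∧ HyperoctahedralRP.InversionUpgradeNormalised) :=
  moebiusLimitOfTwoPointLaw_iff_subs'

/-- Each child is NECESSARY given item 0634: the crux and the two-point law give bare existence (4738) …
[cite: DuminilCopinICM2022, §8.4 p. 29] -/
theorem limitExists_of_subsParent (h : BernsteinTemperature.MoebiusLimitOfTwoPointLaw)
    (hP : IsingEuclidUpgrade.IsingEuclidUpgradeR2RotInvPowerLaw) : WeylWindow.LimitExists :=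
  ((moebiusLimitOfTwoPointLaw_iff_subs.1 h) hP).1

/-- … and the inversion upgrade for every normalised Euclidean scale-covariant limit (1982).
[cite: DuminilCopinICM2022, §8.4 p. 29] -/
theorem inversionUpgradeNormalised_of_subsParent (h : BernsteinTemperature.MoebiusLimitOfTwoPointLaw)
    (hP : IsingEuclidUpgrade.IsingEuclidUpgradeR2RotInvPowerLaw) : HyperoctahedralRP.InversionUpgradeNormalised :=
  ((moebiusLimitOfTwoPointLaw_iff_subs.1 h) hP).2

/-- Under item 0634 the conclusion of item 1980 `HyperoctahedralRP.LimitRotationInvariant` holds by name (landed edge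
`limitRotationInvariant_of_rotationUpgradeFromTwoPoint` + the proof of 8367). [folklore] -/
theorem limitRotationInvariant_holds_of_twoPointLaw (hP : IsingEuclidUpgrade.IsingEuclidUpgradeR2RotInvPowerLaw) :
    HyperoctahedralRP.LimitRotationInvariant :=
  limitRotationInvariant_of_rotationUpgradeFromTwoPoint hP rotationUpgradeFromTwoPoint_proof

end Summit.CriticalPhenomena.Ising3DConformalLimit.BernsteinTemperatureMoebiusLimitOfTwoPointLawSplit

end
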